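import Literature.AlgebraicGeometry.Modules.DetClassTensor
import Literature.AlgebraicGeometry.Modules.DetClassDual
import Literature.AlgebraicGeometry.Modules.PullbackFrame
import Literature.AlgebraicGeometry.AbelianVarieties.HomogeneousLineBundleDivisor
import Literature.AlgebraicGeometry.Motives.AbelianVarietyWeilDivisor
import Literature.AlgebraicGeometry.Motives.AbelianVarietyWeilPairingDeterminesWeilDivisor
import Literature.AlgebraicGeometry.Motives.AbelianVarietyWeilPairingPullback
import HarnessLib

/-!
# The `Λ(𝒪(Θ))`-slice ↔ Weil-divisor dictionary: `t_Q^*𝒪(Θ) ⊗ 𝒪(Θ)⁻¹` versus `D_Q^Θ = t_Q^*Θ − Θ`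
# ([MFK94] Def. 6.2 read in `Ȟ¹(A, 𝒪_A^×)`; Görtz–Wedhorn I Prop. 11.21; Hartshorne III Ex. 4.5)

Topic `AlgebraicGeometry/AbelianVarieties`; namespace `Literature.AlgebraicGeometry.AbelianVarieties`.
KERNEL ONLY: theorems; no definition, no named fact, no instance, no `sorry`.

[MumfordFogartyKirwan1994, Def. 6.2]: «`Λ(L)(x) = T_x^*L ⊗ L⁻¹`»; the tree's ★ D2
`AbelianSchemeOver.IsLambdaOfAt` reads a polarisation through the slices `t_Q^*𝒪(Θ) ⊗ 𝒪(Θ)⁻¹` of the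
Poincaré sheaf, while the tree's Weil pairing `AbelianVariety.weilPairingLevel Θ P Q` (Lang VII §2) is built
on the Weil divisor `AbelianVariety.weilDiv Θ Q = t_Q^*Θ + (−Θ)`.  The dictionary between the two currencies
is the injective group homomorphism `DivCl(A) → Pic(A) = Ȟ¹(A, 𝒪_A^×)` of [GortzWedhorn2020, Prop. 11.21]
(integral `A`; the tree's `cechClass_eq_iff_linEquiv`, `cechClass_add`, `cechClass_pullback`) together with
«rank-one modules are isomorphic iff their determinant classes agree» ([Hartshorne1977, III Ex. 4.5]; the
tree's `nonempty_iso_iff_detClass_eq`, `detClass_pullback`, `detClass_dual`, `detClass_tensorObj_of_hasRank_one`):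

* `detClass_translateTensorDual_eq_cechClass_weilDiv`: `[t_Q^*𝒪(Θ) ⊗ 𝒪(Θ)⁻¹] = [𝒪(D_Q^Θ)]`;
* `weilDiv_linEquiv_iff_nonempty_translateTensorDual_iso`: `D^{Θ₂}_{Q₂} ∼ D^{Θ₁}_{Q₁}` iff the two
  slices are isomorphic;
* `weilPairingLevel_eq_of_weilDiv_linEquiv` / `…_of_nonempty_translateTensorDual_iso`: equal classes
  (isomorphic slices) give equal level Weil pairings (Lang VII §2 Prop. 3: `ē` depends on the class);
* `nonempty_translateTensorDual_iso_of_forall_weilPairingLevel_eq_zpow`: over `K = K̄` with `N` invertible,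
  proportional pairings `ē^{Θ₂}_N(·, Q) = ē^{Θ₁}_N(·, Q)^a` give `t_Q^*𝒪(Θ₂) ⊗ 𝒪(Θ₂)⁻¹ ≅ t_{Q^a}^*𝒪(Θ₁) ⊗ 𝒪(Θ₁)⁻¹`
  (★ `weilDiv_linEquiv_weilDiv_zpow_of_forall_weilPairingLevel_eq_zpow`, Lang VII §2 Prop. 4).

Use (cell `hodgecm-mathlib`, W3c (c-iii) step (D-2)): composed with the ★ D2 uniqueness of classifying maps
(`DualPair.eq_of_nonempty_iso`, «`λ̄₂(Q₂) = λ̄₁(Q₁)` iff the slices are isomorphic») the last theorem is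
«proportional Weil-pairing towers ⇒ `λ̄₂(Q) = λ̄₁(Q^{a_M})`», the hypothesis of ★
`HodgeTheory.AbelianVariety.eq_or_eq_neg_of_forall_torsionPoints_map_eq_pow_of_comp_eq`; the third is the sign step.

## References
* [MumfordFogartyKirwan1994] D. Mumford, J. Fogarty, F. Kirwan, *Geometric Invariant Theory*, 3rd ed.,
  Ch. 6 §2 Def. 6.2 (p. 120).
* [GortzWedhorn2020] U. Görtz, T. Wedhorn, *Algebraic Geometry I*, 2nd ed., Prop. 11.21 (p. 374).
* [Hartshorne1977] R. Hartshorne, *Algebraic Geometry*, II Prop. 6.13/6.15, II Ex. 5.16, III Ex. 4.5.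
* [Lang1983AbelianVarieties] S. Lang, *Abelian Varieties*, Ch. VII §2 Prop. 3 and Prop. 4.
-/

noncomputable section

namespace Literature.AlgebraicGeometry.AbelianVarieties

open CategoryTheory _root_.AlgebraicGeometry MonoidalCategory
open Literature.AlgebraicGeometry.Motives Literature.AlgebraicGeometry.Modules

universe v

variable {K : Type v} [Field K] (A : AbelianVariety K)

/-- **`[t_Q^*𝒪(Θ) ⊗ 𝒪(Θ)⁻¹] = [𝒪(D_Q^Θ)]` in `Ȟ¹(A, 𝒪_A^×)`**, `D_Q^Θ = t_Q^*Θ − Θ` (the tree's `weilDiv`):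
the determinant class of the translate-tensor-dual bundle of [MFK] Def. 6.2's `Λ(𝒪(Θ))(Q)` is the class of the Weil
divisor ([GortzWedhorn2020, Prop. 11.21]: `D ↦ 𝒪(D)` is a homomorphism compatible with pull-back; `[E^∨] = [E]⁻¹`).
[cite: GortzWedhorn2020, Prop. 11.21 (p. 374)] [cite: MumfordFogartyKirwan1994, Ch. 6 §2 Definition 6.2 (p. 120)] -/
theorem detClass_translateTensorDual_eq_cechClass_weilDiv (Θ : CartierDivisor A.X.left) (Q : A.Points K)
    (h : IsFiniteLocallyFree (tensorObj ((Scheme.Modules.pullback (A.translation Q).left).obj (lineBundle Θ.toUnitCocycle))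
      (Modules.dual (lineBundle Θ.toUnitCocycle)))) :
    detClass h = (A.weilDiv Θ Q).cechClass := by
  have h₁ : HasRank ((Scheme.Modules.pullback (A.translation Q).left).obj (lineBundle Θ.toUnitCocycle)) 1 :=
    hasRank_pullback _ Θ.toUnitCocycle.hasRank_lineBundle
  have h₂ : HasRank (Modules.dual (lineBundle Θ.toUnitCocycle)) 1 := hasRank_dual Θ.toUnitCocycle.hasRank_lineBundle
  rw [detClass_tensorObj_of_hasRank_one h₁ h₂ (Θ.toUnitCocycle.isFiniteLocallyFree_lineBundle.pullback _)
      (isFiniteLocallyFree_dual Θ.toUnitCocycle.isFiniteLocallyFree_lineBundle) h,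
    detClass_pullback _ Θ.toUnitCocycle.isFiniteLocallyFree_lineBundle,
    detClass_dual Θ.toUnitCocycle.isFiniteLocallyFree_lineBundle, detClass_lineBundle_toUnitCocycle,
    AbelianVariety.weilDiv, CartierDivisor.cechClass_add, CartierDivisor.cechClass_pullback]
  congr 1
  -- `[𝒪(-Θ)] = [𝒪(Θ)]⁻¹`
  have h0 : (Θ + -Θ).cechClass = 1 := by
    rw [(CartierDivisor.cechClass_eq_iff_linEquiv _ _).2 (CartierDivisor.LinEquiv.add_neg (CartierDivisor.LinEquiv.refl Θ)),
      CartierDivisor.cechClass_zero]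
  rw [CartierDivisor.cechClass_add] at h0
  exact (eq_inv_of_mul_eq_one_right h0).symm

/-- **THE (D-2) DICTIONARY: `D^{Θ₂}_{Q₂} ∼ D^{Θ₁}_{Q₁}` iff `t_{Q₂}^*𝒪(Θ₂) ⊗ 𝒪(Θ₂)⁻¹ ≅ t_{Q₁}^*𝒪(Θ₁) ⊗ 𝒪(Θ₁)⁻¹`**
(rank-one modules on the integral scheme `A` are isomorphic iff their classes in `Ȟ¹(A, 𝒪_A^×)` agree —
Hartshorne III Ex. 4.5 / II Prop. 6.15, the tree's `nonempty_iso_iff_detClass_eq` — and both classes are the classes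
of the Weil divisors).  This converts [MFK] Def. 6.2's `Λ(𝒪(Θ))`-slices (the currency of ★ D2 `IsLambdaOfAt`) into
the Weil-divisor currency of the tree's `weilPairingLevel`. [cite: Hartshorne1977, III Ex. 4.5]
[cite: GortzWedhorn2020, Prop. 11.21 (p. 374)] [cite: MumfordFogartyKirwan1994, Ch. 6 §2 Definition 6.2 (p. 120)] -/
theorem weilDiv_linEquiv_iff_nonempty_translateTensorDual_iso (Θ₁ Θ₂ : CartierDivisor A.X.left) (Q₁ Q₂ : A.Points K) :
    (A.weilDiv Θ₂ Q₂).LinEquiv (A.weilDiv Θ₁ Q₁) ↔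
      Nonempty (tensorObj ((Scheme.Modules.pullback (A.translation Q₂).left).obj (lineBundle Θ₂.toUnitCocycle))
          (Modules.dual (lineBundle Θ₂.toUnitCocycle)) ≅
        tensorObj ((Scheme.Modules.pullback (A.translation Q₁).left).obj (lineBundle Θ₁.toUnitCocycle))
          (Modules.dual (lineBundle Θ₁.toUnitCocycle))) := by
  have hr : ∀ (Θ : CartierDivisor A.X.left) (Q : A.Points K),
      HasRank (tensorObj ((Scheme.Modules.pullback (A.translation Q).left).obj (lineBundle Θ.toUnitCocycle))
        (Modules.dual (lineBundle Θ.toUnitCocycle))) 1 := fun Θ Q =>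
    hasRank_tensorObj_one (hasRank_pullback _ Θ.toUnitCocycle.hasRank_lineBundle)
      (hasRank_dual Θ.toUnitCocycle.hasRank_lineBundle)
  rw [nonempty_iso_iff_detClass_eq (hr Θ₂ Q₂) (hr Θ₁ Q₁) (HasRank.isFiniteLocallyFree' (hr Θ₂ Q₂))
      (HasRank.isFiniteLocallyFree' (hr Θ₁ Q₁)),
    detClass_translateTensorDual_eq_cechClass_weilDiv A, detClass_translateTensorDual_eq_cechClass_weilDiv A,
    CartierDivisor.cechClass_eq_iff_linEquiv]

/-! ### (D-2), pairing side: proportional level Weil pairings ⇒ isomorphic `Λ(𝒪(Θ))`-bundles -/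

/-- **Equal `D_Q`-classes give equal pairings** (converse direction of Lang VII §2 Prop. 4's use: `ē^Θ_N(·, Q)`
depends only on the class of `D^Θ_Q`, the tree's `weilPairingLevel_eq_kummerConst_of_linEquiv`): if
`D^{Θ₂}_{Q₂} ∼ D^{Θ₁}_{Q₁}` then `ē^{Θ₂}_N(P, Q₂) = ē^{Θ₁}_N(P, Q₁)` for every `P ∈ A[N](K)`.
[cite: Lang1983AbelianVarieties, Ch. VII §2 Prop. 3] -/
theorem weilPairingLevel_eq_of_weilDiv_linEquiv {N : ℕ} [IsDominant (AbelianVariety.Hom.toSchemeHom ((N : ℤ) • 𝟙 A))]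
    {Θ₁ Θ₂ : CartierDivisor A.X.left} {Q₁ Q₂ : A.torsionPoints K N}
    (h : (A.weilDiv Θ₂ Q₂.1).LinEquiv (A.weilDiv Θ₁ Q₁.1)) (P : A.torsionPoints K N) :
    A.weilPairingLevel Θ₂ P Q₂ = A.weilPairingLevel Θ₁ P Q₁ :=
  AbelianVariety.weilPairingLevel_eq_kummerConst_of_linEquiv (A.isTrivializer_weilFn Θ₁ Q₁) h P

/-- **Isomorphic `Λ(𝒪(Θ))`-slices give equal pairings**: if `t_{Q₂}^*𝒪(Θ₂) ⊗ 𝒪(Θ₂)⁻¹ ≅ t_{Q₁}^*𝒪(Θ₁) ⊗ 𝒪(Θ₁)⁻¹` then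
`ē^{Θ₂}_N(P, Q₂) = ē^{Θ₁}_N(P, Q₁)` for all `P ∈ A[N](K)` (the dictionary, then the class-dependence of `ē`).
[cite: Lang1983AbelianVarieties, Ch. VII §2 Prop. 3] [cite: MumfordFogartyKirwan1994, Ch. 6 §2 Definition 6.2 (p. 120)] -/
theorem weilPairingLevel_eq_of_nonempty_translateTensorDual_iso {N : ℕ}
    [IsDominant (AbelianVariety.Hom.toSchemeHom ((N : ℤ) • 𝟙 A))]
    {Θ₁ Θ₂ : CartierDivisor A.X.left} {Q₁ Q₂ : A.torsionPoints K N}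
    (h : Nonempty (tensorObj ((Scheme.Modules.pullback (A.translation Q₂.1).left).obj (lineBundle Θ₂.toUnitCocycle))
          (Modules.dual (lineBundle Θ₂.toUnitCocycle)) ≅
        tensorObj ((Scheme.Modules.pullback (A.translation Q₁.1).left).obj (lineBundle Θ₁.toUnitCocycle))
          (Modules.dual (lineBundle Θ₁.toUnitCocycle))))
    (P : A.torsionPoints K N) : A.weilPairingLevel Θ₂ P Q₂ = A.weilPairingLevel Θ₁ P Q₁ :=
  weilPairingLevel_eq_of_weilDiv_linEquiv A
    ((weilDiv_linEquiv_iff_nonempty_translateTensorDual_iso A Θ₁ Θ₂ Q₁.1 Q₂.1).2 h) P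

/-- **(D-2), pairing side: PROPORTIONAL PAIRINGS ⇒ ISOMORPHIC `Λ(𝒪(Θ))`-SLICES.**  Over an algebraically closed field in
which `N` is invertible, if `ē^{Θ₂}_N(P, Q) = ē^{Θ₁}_N(P, Q)^a` for all `P ∈ A[N](K)` then
`t_Q^*𝒪(Θ₂) ⊗ 𝒪(Θ₂)⁻¹ ≅ t_{Q^a}^*𝒪(Θ₁) ⊗ 𝒪(Θ₁)⁻¹` (★ `weilDiv_linEquiv_weilDiv_zpow_of_forall_weilPairingLevel_eq_zpow`,
Lang VII §2 Prop. 4, then the dictionary).  Read through ★ D2 `IsLambdaOfAt` and the injectivity of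
`b ↦ [𝒫|_{A × {b}}]` this is «`λ̄₂(Q) = λ̄₁(Q^a)`», the hypothesis of ★
`HodgeTheory.AbelianVariety.eq_or_eq_neg_of_forall_torsionPoints_map_eq_pow_of_comp_eq`.
[cite: Lang1983AbelianVarieties, Ch. VII §2 Prop. 4] [cite: MumfordFogartyKirwan1994, Ch. 6 §2 Definition 6.2 (p. 120)] -/
theorem nonempty_translateTensorDual_iso_of_forall_weilPairingLevel_eq_zpow [IsAlgClosed K] {N : ℕ} (hNK : (N : K) ≠ 0)
    [IsDominant (AbelianVariety.Hom.toSchemeHom ((N : ℤ) • 𝟙 A))]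
    (Θ₁ Θ₂ : CartierDivisor A.X.left) (Q : A.torsionPoints K N) (a : ℤ)
    (h : ∀ P : A.torsionPoints K N, A.weilPairingLevel Θ₂ P Q = A.weilPairingLevel Θ₁ P Q ^ a) :
    Nonempty (tensorObj ((Scheme.Modules.pullback (A.translation Q.1).left).obj (lineBundle Θ₂.toUnitCocycle))
        (Modules.dual (lineBundle Θ₂.toUnitCocycle)) ≅
      tensorObj ((Scheme.Modules.pullback (A.translation (Q.1 ^ a)).left).obj (lineBundle Θ₁.toUnitCocycle))
        (Modules.dual (lineBundle Θ₁.toUnitCocycle))) :=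
  (weilDiv_linEquiv_iff_nonempty_translateTensorDual_iso A Θ₁ Θ₂ (Q.1 ^ a) Q.1).1
    (AbelianVariety.weilDiv_linEquiv_weilDiv_zpow_of_forall_weilPairingLevel_eq_zpow hNK Θ₁ Θ₂ Q a h)

/-! ### Edition 2: pulling the `Λ(𝒪(Θ))`-slice back along a homomorphism -/

/-- **`φ^*(t_{φP′}^*𝒪(Θ) ⊗ 𝒪(Θ)⁻¹) ≅ t_{P′}^*𝒪(φ^*Θ) ⊗ 𝒪(φ^*Θ)⁻¹`** for a dominant homomorphism `φ : A′ → A`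
(e.g. an isomorphism of fibres), a Cartier divisor `Θ` on `A` and a point `P′` of `A′`: both sides are rank-one and their
classes in `Ȟ¹(A′, 𝒪^×)` are `[φ^* D^Θ_{φP′}] = [D^{φ^*Θ}_{P′}]` ([MumfordAV1970, §20 (3)] `t_{P′} ≫ φ = φ ≫ t_{φP′}`, the tree's
`weilDiv_pullback_sameDivisor`; `[det φ^*E] = φ^*[det E]`, Hartshorne II Ex. 6.8).  This is the module-algebra step of
transporting [MFK] Def. 6.2's `Λ(𝒪(Θ))`-reading (`IsLambdaOfAt`) along an isomorphism of fibres.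
[cite: MumfordAV1970, §20 (property (3) of e_n, p. 186)] [cite: Hartshorne1977, II Ex. 6.8 and III Ex. 4.5]
[cite: MumfordFogartyKirwan1994, Ch. 6 §2 Definition 6.2 (p. 120)] -/
theorem nonempty_pullback_translateTensorDual_iso {A' : AbelianVariety K} (φ : A' ⟶ A)
    [IsDominant (AbelianVariety.Hom.toSchemeHom φ)] (Θ : CartierDivisor A.X.left) (P' : A'.Points K) :
    Nonempty ((Scheme.Modules.pullback (AbelianVariety.Hom.toSchemeHom φ)).obj
        (tensorObj ((Scheme.Modules.pullback (A.translation (AlgPoints.map φ.hom.hom.hom P')).left).obj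
            (lineBundle Θ.toUnitCocycle)) (Modules.dual (lineBundle Θ.toUnitCocycle))) ≅
      tensorObj ((Scheme.Modules.pullback (A'.translation P').left).obj
          (lineBundle (Θ.pullback (AbelianVariety.Hom.toSchemeHom φ)).toUnitCocycle))
        (Modules.dual (lineBundle (Θ.pullback (AbelianVariety.Hom.toSchemeHom φ)).toUnitCocycle))) := by
  -- ranks
  have hr : ∀ (B : AbelianVariety K) (Ξ : CartierDivisor B.X.left) (Q : B.Points K),
      HasRank (tensorObj ((Scheme.Modules.pullback (B.translation Q).left).obj (lineBundle Ξ.toUnitCocycle))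
        (Modules.dual (lineBundle Ξ.toUnitCocycle))) 1 := fun B Ξ Q =>
    hasRank_tensorObj_one (hasRank_pullback _ Ξ.toUnitCocycle.hasRank_lineBundle)
      (hasRank_dual Ξ.toUnitCocycle.hasRank_lineBundle)
  have h₁ := hr A Θ (AlgPoints.map φ.hom.hom.hom P')
  have hE : IsFiniteLocallyFree (tensorObj
      ((Scheme.Modules.pullback (A.translation (AlgPoints.map φ.hom.hom.hom P')).left).obj (lineBundle Θ.toUnitCocycle))
      (Modules.dual (lineBundle Θ.toUnitCocycle))) := HasRank.isFiniteLocallyFree' h₁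
  rw [nonempty_iso_iff_detClass_eq (hasRank_pullback _ h₁) (hr A' _ P') (hE.pullback _)
      (HasRank.isFiniteLocallyFree' (hr A' _ P')),
    detClass_pullback _ hE, detClass_translateTensorDual_eq_cechClass_weilDiv A,
    detClass_translateTensorDual_eq_cechClass_weilDiv A', ← CartierDivisor.cechClass_pullback,
    CartierDivisor.cechClass_eq_iff_linEquiv]
  exact (AbelianVariety.weilDiv_pullback_sameDivisor φ Θ P').linEquiv.symm

end Literature.AlgebraicGeometry.AbelianVarieties

end
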